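import Summits.AtomisticToContinuum.FouriersLaw.Theses.JunctionLocality
import Summits.AtomisticToContinuum.FouriersLaw.Theses.ParityLiouvilleSeed
import Literature.Barriers.AtomisticToContinuum.HarmonicCrystalBallisticProofs

/-!
# Disproof of `SuperadditiveResistance` — findings of the standing adversary (cdisprove seat)

Crux item `stmt-AtomisticToContinuum-11748`, decl
`Summit.AtomisticToContinuum.FouriersLaw.Theses.JunctionLocality.SuperadditiveResistance`
(verbatim twin: `…Theses.ParityLiouvilleSeed.SuperadditiveResistance`, see `twin_eq`).
Informally: for `pinnedChain ω₂ lam β γ` (all `> 0`), under weak-NESS uniqueness, along every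
steady-state family, for every `T > 0` and response coefficients `D_N > 0` (`N ≥ 2`) there is
`C = C(ω₂, lam, β, γ, T)` with `R_{N+M} ≥ R_N + R_M - C` (`N, M ≥ 2`), `R_N := (N-1)/D_N`
(bounded reservoir-insertion cost).

VERDICT SO FAR: **resists** (not refuted).  Everything below is `lean check`ed (rc 0); the only
`sorry`s are in §5 (near-misses, documented as such).  LANDED (importable, sorry-free) copies of §0–§3:
`Summits.AtomisticToContinuum.FouriersLaw.Theorems.SuperadditiveResistance.Negative.KillCriteria` (p86498,
read-back, shell-false, kill criteria, slab dichotomy) and `….Negative.HarmonicCornerTightness` (p87069, §3),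
namespace `Summit.AtomisticToContinuum.FouriersLaw.Theorems.SuperadditiveResistance.Negative`.

## Index

* §0 `InsertionBounded`, `superadditiveResistance_iff` (read-back `Iff.rfl`), `twin_eq` (`rfl`).
* §1 LOAD-BEARING ANALYSIS.  `WithoutDynamics` (= the crux with `hU`, `hμ`, `hD` all dropped: the
  bare arithmetic shell over positive `D`) is FALSE: `superadditiveResistance_false_without_dynamics`.
  The three dynamical hypotheses cannot be separated from each other inside Lean today (the NESS
  response `D_N` is computable in the tree only at the harmonic corner), so "any proof must use the
  dynamics" is the sharpest load-bearing statement available; see §4 for why dropping `hU` alone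
  gives no refutation handle either.
* §2 KILL CRITERIA (pure real analysis, the operative content of (A)):
  - `InsertionBounded.doubling`: (A) ⇒ the doubling defect `2R_N - R_{2N}` is bounded above;
  - `not_insertionBounded_of_doubling_excess`: an affine law plus a correction `e` with
    `2e_N - e_{2N} → +∞` kills (A);
  - `not_insertionBounded_of_rpow_correction`: `R_N = ℓN + a + b·N^s`, `b > 0`, `0 < s < 1` kills (A)
    (anomalous / slow finite-size corrections, `κ - κ_N ≫ 1/N` from below);
  - `not_insertionBounded_of_log_correction`: `R_N = ℓN + a + b·log N`, `b > 0` kills (A) — the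
    MARGINAL case, and exactly what a kinetic caricature produces at the `lam = 0` edge (§4 (iii));
  - `insertionBounded_of_subadditive_dip`: `R_N = ℓN + a - e_N` with `e` subadditive (e.g.
    `e_N = b·N^s`, `b ≥ 0`, `0 ≤ s ≤ 1`: `insertionBounded_of_rpow_dip`) SATISFIES (A): (A) is
    ONE-SIDED — it does not see a slow approach of `D_N` to `κ` from ABOVE; only two-sided locality
    (`JunctionDichotomy`) pins the `1/N` rate.
* §2b SLAB CARICATURE (pure algebra): `slab_doubling_defect_ge` — for parallel ballistic-then-
  diffusive channels `(w_m, ℓ_m)`, `2R_N - R_{2N} ≥ Σ_{ℓ_m ≤ N} w_m ℓ_m²/(3κ²)`: bounded insertion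
  cost ⟺ bounded `w`-second moment of the mean free path (the quantity junction repair must bound);
  `slab_insertion_defect_le` — conversely `R_x + R_y - R_{x+y} ≤ 4M₂/κ²` for `x, y ≥ 2M₂/κ`.
* §3 TIGHTNESS AT THE HARMONIC CORNER (rigorous, from the tree's exact solution):
  `harmonic_corner_constant_ge_ballistic_resistance` — along `harmonicNESS ω₂ γ` the response is
  `D_N = (N-1)·fluxCoeff ω₂ γ N`, positive for `N ≥ 2`, and the superadditivity defect tends to the
  ballistic resistance `1/fluxLimit ω₂ γ = 2(1+γ²)/(γ·r(ω₂,γ))`, so (A) FAILS there for every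
  `C < 1/fluxLimit ω₂ γ` (in particular for `C = 0`: `harmonic_corner_not_superadditive`).  Hence no
  constant uniform in `(ω₂, γ)` can work near the corner (`1/fluxLimit → ∞` as `ω₂ → ∞` or `γ → 0, ∞`),
  and — granted continuity of the fixed-`N` response in `(lam, β)`, expected but not in the tree —
  `C(ω₂, lam, β, γ, T) ≥ 1/fluxLimit ω₂ γ - o(1)` as `(lam, β) → 0`, equivalently (exact scaling
  `D_N(T; lam, β) = D_N(1; lam T, β T)`, barrier `LowTemperatureWeakAnharmonicity`) as `T → 0`.
* §4 WHY IT RESISTS (docstring `why_it_resists`): the formalisation is faithful (no junk handle);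
  every refutation must (a) PROVE the fixed-`N` theory the hypotheses encode (uniqueness `hU`,
  existence of the response limit, positivity) — if any of these failed the crux would be VACUOUSLY
  TRUE, not false — and (b) prove an anomalous finite-size LOWER bound `2R_N - R_{2N} → ∞` for a
  pinned, doubly anharmonic chain; nothing of kind (b) exists for any deterministic anharmonic chain
  (BLR 2000 §6.3), and kinetic theory predicts the opposite for `lam > 0` (bounded mean free path).
* §5 NEAR-MISSES / regimes tried, as `sorry`-marked conjectural signatures with the obstruction in
  the docstring: the `lam = 0` edge (log-divergent insertion cost in the kinetic caricature) and the
  harmonic corner transfer (needs continuity of `D_N` in `(lam, β)` at fixed `N`).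

* §6 PROXY COMPUTATION (exact second-moment NESS, job `j013120`): ballistic regression passed
  (`R_N → 8 = 1/fluxLimit 1 1` to `1e-13`); flip noise ⇒ `R_N = 10.4721 N - 6.0237` affine, (A) holds;
  momentum-exchange noise (the `lam = 0`-edge structure) ⇒ `Δ_N = 2R_N - R_{2N}` grows
  0.88 → 3.61 (`N = 4 … 64`) with increasing increments, (A) fails — the mechanism of §4 (iii)
  confirmed in an exact model; `j014402` (`N ≤ 512`) pending for log-vs-√N.

* §7 LINE `floating-probe-bypass-laplacian` (lead b): stub audit; `kuboLink_calibration_L2` +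
  `fluxCoeff_one_one_two` calibrate the Kubo link S0c at the harmonic `L = 2` point (`= 1/6` both ways);
  exact legs bed `j014552`: flip ⇒ all four legs constant (S1–S3 hold with explicit constants); exchange ⇒
  S1, S2 legs bounded (edge-robust), S3 leg carries the whole divergence (0.11 → 3.53, `L = 8 → 192`).

Compute: NEMD of the crux's own chain is not attempted (the defect is `O(1)` on top of `R_N = O(N)`;
deciding bounded-vs-log needs relative precision `≪ 1/N` on NESS currents at `N ≳ 10²` — §4 (vi));
the one-shot refuter's NEMD probe `j003758` belongs to another seat and is not visible from here.
-/

noncomputable section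

namespace Summit.AtomisticToContinuum.FouriersLaw.Cruxes.SuperadditiveResistance.Disproof

open MeasureTheory Filter Topology
open Literature.MathematicalPhysics.KineticTheory.HeatConduction
open Summit.AtomisticToContinuum.FouriersLaw.Theses

/-! ## §0 Read-back -/

/-- The conclusion of the crux for a response sequence `D`: bounded insertion cost,
`∃ C, ∀ N M ≥ 2, R_N + R_M - C ≤ R_{N+M}` with `R_N := (N-1)/D_N`. -/
def InsertionBounded (D : ℕ → ℝ) : Prop :=
  ∃ C : ℝ, ∀ N M : ℕ, 2 ≤ N → 2 ≤ M →
    ((N : ℝ) - 1) / D N + ((M : ℝ) - 1) / D M - C ≤ ((N : ℝ) + (M : ℝ) - 1) / D (N + M)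

/-- Read-back (definitional): the crux is "dynamical hypotheses ⇒ `InsertionBounded D`". -/
theorem superadditiveResistance_iff :
    JunctionLocality.SuperadditiveResistance ↔
      ∀ ω₂ lam β γ : ℝ, 0 < ω₂ → 0 < lam → 0 < β → 0 < γ →
        (∀ (N : ℕ) (T_L T_R : ℝ), 0 < T_L → 0 < T_R → ∀ μ ν : Measure (PhaseSpace N),
          (pinnedChain ω₂ lam β γ).IsSteadyState N T_L T_R μ →
          (pinnedChain ω₂ lam β γ).IsSteadyState N T_L T_R ν → μ = ν) →
        ∀ μ : (N : ℕ) → ℝ → ℝ → Measure (PhaseSpace N),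
          (∀ (N : ℕ) (T_L T_R : ℝ), 0 < T_L → 0 < T_R →
            (pinnedChain ω₂ lam β γ).IsSteadyState N T_L T_R (μ N T_L T_R)) →
          ∀ T : ℝ, 0 < T → ∀ D : ℕ → ℝ,
            (∀ N : ℕ, Tendsto (fun δ : ℝ =>
                (pinnedChain ω₂ lam β γ).totalCurrent (μ N (T + δ / 2) (T - δ / 2)) / δ)
              (𝓝[≠] 0) (𝓝 (D N))) →
            (∀ N : ℕ, 2 ≤ N → 0 < D N) → InsertionBounded D :=
  Iff.rfl

/-- The two route copies of the crux are the same proposition. -/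
theorem twin_eq :
    ParityLiouvilleSeed.SuperadditiveResistance = JunctionLocality.SuperadditiveResistance :=
  rfl

/-! ## §2 Kill criteria (pure real analysis) — stated first, §1 uses them -/

/-- (A) ⇒ the doubling defect is bounded: `2 R_N - C ≤ R_{2N}` for all `N ≥ 2`. -/
theorem InsertionBounded.doubling {D : ℕ → ℝ} (h : InsertionBounded D) :
    ∃ C : ℝ, ∀ N : ℕ, 2 ≤ N →
      2 * (((N : ℝ) - 1) / D N) - C ≤ ((N : ℝ) + (N : ℝ) - 1) / D (N + N) := by
  obtain ⟨C, hC⟩ := h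
  refine ⟨C, fun N hN => ?_⟩
  have := hC N N hN hN
  linarith

/-- Kill criterion (abstract): if `R_N = ℓ·N + a + e_N` for `N ≥ 2` and the doubling excess
`2 e_N - e_{2N}` is unbounded above (tends to `+∞`), then (A) fails. -/
theorem not_insertionBounded_of_doubling_excess {D : ℕ → ℝ} (ℓ a : ℝ) (e : ℕ → ℝ)
    (hR : ∀ N : ℕ, 2 ≤ N → ((N : ℝ) - 1) / D N = ℓ * N + a + e N)
    (he : Tendsto (fun N : ℕ => 2 * e N - e (2 * N)) atTop atTop) :
    ¬ InsertionBounded D := by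
  intro h
  obtain ⟨C, hC⟩ := h.doubling
  obtain ⟨N₀, hN₀⟩ := (tendsto_atTop_atTop.mp he) (C - a + 1)
  set N := max N₀ 2 with hNdef
  have hN2 : 2 ≤ N := le_max_right _ _
  have hNN : 2 ≤ N + N := by omega
  have h1 := hC N hN2
  have h2 := hN₀ N (le_max_left _ _)
  rw [hR N hN2] at h1
  have h3 : ((N : ℝ) + (N : ℝ) - 1) / D (N + N) = ℓ * ((N + N : ℕ) : ℝ) + a + e (N + N) := by
    rw [← hR (N + N) hNN]; push_cast; ring
  rw [h3] at h1
  have h4 : e (2 * N) = e (N + N) := by rw [two_mul]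
  rw [h4] at h2
  push_cast at h1
  linarith

/-- Kill criterion (power law): `R_N = ℓ·N + a + b·N^s` with `b > 0`, `0 < s < 1` violates (A)
(`2bN^s - b(2N)^s = b(2 - 2^s)N^s → ∞`).  This is the "finite-size corrections slower than `1/N`"
kill of the card: `κ_N = (N-1)/R_N` approaches `κ = 1/ℓ` from BELOW like `N^{s-1} ≫ 1/N`. -/
theorem not_insertionBounded_of_rpow_correction {D : ℕ → ℝ} (ℓ a b s : ℝ) (hb : 0 < b)
    (hs0 : 0 < s) (hs1 : s < 1)
    (hR : ∀ N : ℕ, 2 ≤ N → ((N : ℝ) - 1) / D N = ℓ * N + a + b * (N : ℝ) ^ s) :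
    ¬ InsertionBounded D := by
  refine not_insertionBounded_of_doubling_excess ℓ a (fun N => b * (N : ℝ) ^ s) hR ?_
  have h2s : (2 : ℝ) ^ s < 2 := by
    have := Real.rpow_lt_self_of_one_lt (by norm_num : (1 : ℝ) < 2) hs1
    simpa using this
  have hcoef : 0 < b * (2 - (2 : ℝ) ^ s) := mul_pos hb (by linarith)
  have hlim : Tendsto (fun N : ℕ => b * (2 - (2 : ℝ) ^ s) * (N : ℝ) ^ s) atTop atTop :=
    Tendsto.const_mul_atTop hcoef
      ((tendsto_rpow_atTop hs0).comp tendsto_natCast_atTop_atTop)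
  refine hlim.congr fun N => ?_
  have hN : (0 : ℝ) ≤ N := Nat.cast_nonneg N
  push_cast
  rw [Real.mul_rpow (by norm_num : (0 : ℝ) ≤ 2) hN]
  ring

/-- Kill criterion (logarithm, the marginal case): `R_N = ℓ·N + a + b·log N` with `b > 0` violates
(A) (`2b log N - b log(2N) = b log(N/2) → ∞`), i.e. already `κ - κ_N ≍ (log N)/N` from below kills
the crux.  See §4 (iii): this is what a kinetic (Peierls–Boltzmann slab) caricature gives for the
`lam = 0` edge of the family (FPU-β interaction + harmonic pinning). -/
theorem not_insertionBounded_of_log_correction {D : ℕ → ℝ} (ℓ a b : ℝ) (hb : 0 < b)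
    (hR : ∀ N : ℕ, 2 ≤ N → ((N : ℝ) - 1) / D N = ℓ * N + a + b * Real.log N) :
    ¬ InsertionBounded D := by
  refine not_insertionBounded_of_doubling_excess ℓ a (fun N => b * Real.log N) hR ?_
  have hlog : Tendsto (fun N : ℕ => Real.log (N : ℝ)) atTop atTop :=
    Real.tendsto_log_atTop.comp tendsto_natCast_atTop_atTop
  have hlim : Tendsto (fun N : ℕ => b * (Real.log (N : ℝ) - Real.log 2)) atTop atTop :=
    Tendsto.const_mul_atTop hb (tendsto_atTop_add_const_right _ _ hlog)
  refine hlim.congr' ?_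
  filter_upwards [eventually_ge_atTop 1] with N hN
  have hN : (N : ℝ) ≠ 0 := by exact_mod_cast (show N ≠ 0 by omega)
  push_cast
  rw [Real.log_mul (by norm_num) hN]
  ring

/-- One-sidedness: `R_N = ℓ·N + a - e_N` with a SUBADDITIVE dip `e` (`e_{N+M} ≤ e_N + e_M`)
satisfies (A) with `C = a`.  So (A) alone tolerates arbitrarily slow approach of `κ_N` to `κ` from
ABOVE; the `1/N` rate is pinned only by two-sided locality (`JunctionDichotomy`). -/
theorem insertionBounded_of_subadditive_dip {D : ℕ → ℝ} (ℓ a : ℝ) (e : ℕ → ℝ)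
    (hR : ∀ N : ℕ, 2 ≤ N → ((N : ℝ) - 1) / D N = ℓ * N + a - e N)
    (he : ∀ N M : ℕ, 2 ≤ N → 2 ≤ M → e (N + M) ≤ e N + e M) :
    InsertionBounded D := by
  refine ⟨a, fun N M hN hM => ?_⟩
  have hNM : 2 ≤ N + M := by omega
  have h3 : ((N : ℝ) + (M : ℝ) - 1) / D (N + M) = ℓ * ((N + M : ℕ) : ℝ) + a - e (N + M) := by
    rw [← hR (N + M) hNM]; push_cast; ring
  rw [hR N hN, hR M hM, h3]
  have := he N M hN hM
  push_cast
  linarith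

/-- The power-law dip `e_N = b·N^s`, `b ≥ 0`, `0 ≤ s ≤ 1`, is subadditive, so
`R_N = ℓ·N + a - b·N^s` satisfies (A): `κ_N → κ` from above like `N^{s-1}` is invisible to (A). -/
theorem insertionBounded_of_rpow_dip {D : ℕ → ℝ} (ℓ a b s : ℝ) (hb : 0 ≤ b) (hs0 : 0 ≤ s)
    (hs1 : s ≤ 1) (hR : ∀ N : ℕ, 2 ≤ N → ((N : ℝ) - 1) / D N = ℓ * N + a - b * (N : ℝ) ^ s) :
    InsertionBounded D := by
  refine insertionBounded_of_subadditive_dip ℓ a (fun N => b * (N : ℝ) ^ s) hR ?_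
  intro N M _ _
  have hN : (0 : ℝ) ≤ N := Nat.cast_nonneg N
  have hM : (0 : ℝ) ≤ M := Nat.cast_nonneg M
  have h := Real.rpow_add_le_add_rpow hN hM hs0 hs1
  push_cast
  nlinarith [h, hb]

/-! ## §2b Spectral slab caricature: the insertion defect is the second moment of the mean free path -/

/-- **Slab caricature of the junction-repair cost.**  Finitely many channels `m ∈ S` (phonon modes)
with weights `w_m ≥ 0` (velocity × contact transmission) and mean free paths `ℓ_m > 0` conduct in
parallel through a slab of length `x`, each as a ballistic-then-diffusive resistor:
`κ_x := Σ_m w_m ℓ_m · x/(x + ℓ_m)` (so `G_x = κ_x/x = Σ_m w_m/(1 + x/ℓ_m)`, `κ_x ↑ κ := Σ_m w_m ℓ_m`),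
`R_x := x/κ_x`.  Then for every `N > 0` the DOUBLING DEFECT obeys
`2R_N - R_{2N} ≥ (Σ_{ℓ_m ≤ N} w_m ℓ_m²)/(3κ²)`: it dominates the `w`-second moment of the mean free
paths below `N`.  Consequently, in this caricature, bounded insertion cost (the crux (A)) forces
`Σ_m w_m ℓ_m² = O(κ²·C)` uniformly — an UNBOUNDED second moment of the mean-free-path distribution
(long waves with `ℓ(k) ≍ 1/k`, `w ≍ k`: the `lam = 0` edge of §4 (iii)) kills (A) even when
`κ = Σ w ℓ < ∞` (normal conductivity).  This is the quantity a junction-repair lemma must control;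
nothing here is specific to the chain (pure algebra of parallel affine resistors). -/
theorem slab_doubling_defect_ge {ι : Type*} (S : Finset ι) (w ℓ : ι → ℝ)
    (hw : ∀ m ∈ S, 0 ≤ w m) (hℓ : ∀ m ∈ S, 0 < ℓ m) (hκ : 0 < ∑ m ∈ S, w m * ℓ m)
    (κN : ℝ → ℝ) (hκN : ∀ x, κN x = ∑ m ∈ S, w m * ℓ m * (x / (x + ℓ m)))
    {N : ℝ} (hN : 0 < N) :
    (∑ m ∈ S.filter (fun m => ℓ m ≤ N), w m * ℓ m ^ 2) / (3 * (∑ m ∈ S, w m * ℓ m) ^ 2)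
      ≤ 2 * (N / κN N) - 2 * N / κN (2 * N) := by
  set κ := ∑ m ∈ S, w m * ℓ m with hκdef
  -- basic bounds on κ_N
  have hterm_nonneg : ∀ x : ℝ, 0 < x → ∀ m ∈ S, 0 ≤ w m * ℓ m * (x / (x + ℓ m)) := by
    intro x hx m hm
    have := hw m hm; have := hℓ m hm
    positivity
  have hle : ∀ x : ℝ, 0 < x → κN x ≤ κ := by
    intro x hx
    rw [hκN]
    refine Finset.sum_le_sum fun m hm => ?_
    have h1 : x / (x + ℓ m) ≤ 1 := by
      rw [div_le_one (by linarith [hℓ m hm])]; linarith [hℓ m hm]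
    have h0 : 0 ≤ w m * ℓ m := mul_nonneg (hw m hm) (hℓ m hm).le
    calc w m * ℓ m * (x / (x + ℓ m)) ≤ w m * ℓ m * 1 :=
          mul_le_mul_of_nonneg_left h1 h0
      _ = w m * ℓ m := mul_one _
  have hposN : ∀ x : ℝ, 0 < x → 0 < κN x := by
    intro x hx
    obtain ⟨m, hm, hmpos⟩ : ∃ m ∈ S, (0 : ℝ) < w m * ℓ m := by
      have : ∑ m ∈ S, (0 : ℝ) < ∑ m ∈ S, w m * ℓ m := by simpa using hκ
      exact Finset.exists_lt_of_sum_lt this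
    rw [hκN]
    refine Finset.sum_pos' (hterm_nonneg x hx) ⟨m, hm, ?_⟩
    have := hℓ m hm
    exact mul_pos hmpos (div_pos hx (by linarith))
  set a := κN N with ha
  set b := κN (2 * N) with hb
  have ha0 : 0 < a := hposN N hN
  have hb0 : 0 < b := hposN (2 * N) (by linarith)
  have haκ : a ≤ κ := hle N hN
  have hbκ : b ≤ κ := hle (2 * N) (by linarith)
  -- the increment κ_{2N} - κ_N, termwise
  have hdiff : b - a = ∑ m ∈ S, w m * ℓ m ^ 2 * (N / ((2 * N + ℓ m) * (N + ℓ m))) := by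
    rw [hb, ha, hκN, hκN, ← Finset.sum_sub_distrib]
    refine Finset.sum_congr rfl fun m hm => ?_
    have h1 : N + ℓ m ≠ 0 := by linarith [hℓ m hm]
    have h2 : 2 * N + ℓ m ≠ 0 := by linarith [hℓ m hm]
    field_simp
    ring
  -- lower bound of the increment by the second moment of the short mean free paths
  set F := ∑ m ∈ S.filter (fun m => ℓ m ≤ N), w m * ℓ m ^ 2 with hF
  have hF0 : 0 ≤ F := Finset.sum_nonneg fun m hm => by
    have := hw m (Finset.mem_filter.mp hm).1; positivity
  have hincr : F / (6 * N) ≤ b - a := by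
    rw [hdiff]
    calc F / (6 * N) = ∑ m ∈ S.filter (fun m => ℓ m ≤ N), w m * ℓ m ^ 2 / (6 * N) := by
          rw [hF, Finset.sum_div]
      _ ≤ ∑ m ∈ S.filter (fun m => ℓ m ≤ N), w m * ℓ m ^ 2 * (N / ((2 * N + ℓ m) * (N + ℓ m))) := by
          refine Finset.sum_le_sum fun m hm => ?_
          obtain ⟨hmS, hmN⟩ := Finset.mem_filter.mp hm
          have hl := hℓ m hmS
          have hw' := hw m hmS
          have hden : 0 < (2 * N + ℓ m) * (N + ℓ m) := by positivity
          have hfrac : 1 / (6 * N) ≤ N / ((2 * N + ℓ m) * (N + ℓ m)) := by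
            rw [div_le_div_iff₀ (by positivity) hden]
            nlinarith
          have h0 : 0 ≤ w m * ℓ m ^ 2 := by positivity
          calc w m * ℓ m ^ 2 / (6 * N) = w m * ℓ m ^ 2 * (1 / (6 * N)) := by ring
            _ ≤ w m * ℓ m ^ 2 * (N / ((2 * N + ℓ m) * (N + ℓ m))) :=
                mul_le_mul_of_nonneg_left hfrac h0
      _ ≤ ∑ m ∈ S, w m * ℓ m ^ 2 * (N / ((2 * N + ℓ m) * (N + ℓ m))) := by
          refine Finset.sum_le_sum_of_subset_of_nonneg (Finset.filter_subset _ _) ?_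
          intro m hmS _
          have := hw m hmS; have := hℓ m hmS
          positivity
  -- assemble
  have hba : 0 ≤ b - a := le_trans (by positivity) hincr
  have h1 : 2 * (N / a) - 2 * N / b = 2 * N * (b - a) / (a * b) := by
    field_simp
  rw [h1]
  have hab : a * b ≤ κ ^ 2 := by
    rw [sq]; exact mul_le_mul haκ hbκ hb0.le (le_trans ha0.le haκ)
  calc F / (3 * κ ^ 2) = 2 * N * (F / (6 * N)) / κ ^ 2 := by
        field_simp
        ring
    _ ≤ 2 * N * (b - a) / κ ^ 2 := by
        refine div_le_div_of_nonneg_right ?_ (by positivity)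
        exact mul_le_mul_of_nonneg_left hincr (by positivity)
    _ ≤ 2 * N * (b - a) / (a * b) :=
        div_le_div_of_nonneg_left (by positivity) (by positivity) hab

/-- **Converse slab bound (the dichotomy is sharp).**  In the same caricature, once the lengths
exceed `2M₂/κ` (`M₂ := Σ_m w_m ℓ_m²` the `w`-second moment of the mean free paths), the insertion
defect is at most `4M₂/κ²`: `R_x + R_y - R_{x+y} ≤ 4M₂/κ²`.  Together with
`slab_doubling_defect_ge`: in the slab caricature the optimal insertion constant is `≍ M₂/κ²`
(between a third of the truncated second moment and four times the full one), i.e. (A) holds iff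
the mean-free-path distribution has a finite `w`-second moment, and then with `C ≍ M₂/κ²`. -/
theorem slab_insertion_defect_le {ι : Type*} (S : Finset ι) (w ℓ : ι → ℝ)
    (hw : ∀ m ∈ S, 0 ≤ w m) (hℓ : ∀ m ∈ S, 0 < ℓ m) (hκ : 0 < ∑ m ∈ S, w m * ℓ m)
    (κN : ℝ → ℝ) (hκN : ∀ x, κN x = ∑ m ∈ S, w m * ℓ m * (x / (x + ℓ m)))
    {x y : ℝ} (hx0 : 0 < x) (hy0 : 0 < y)
    (hx : 2 * (∑ m ∈ S, w m * ℓ m ^ 2) / (∑ m ∈ S, w m * ℓ m) ≤ x)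
    (hy : 2 * (∑ m ∈ S, w m * ℓ m ^ 2) / (∑ m ∈ S, w m * ℓ m) ≤ y) :
    x / κN x + y / κN y - (x + y) / κN (x + y)
      ≤ 4 * (∑ m ∈ S, w m * ℓ m ^ 2) / (∑ m ∈ S, w m * ℓ m) ^ 2 := by
  set κ := ∑ m ∈ S, w m * ℓ m with hκdef
  set M₂ := ∑ m ∈ S, w m * ℓ m ^ 2 with hM₂
  have hM₂0 : 0 ≤ M₂ := Finset.sum_nonneg fun m hm => by
    have := hw m hm; positivity
  -- κ - κ_z ≤ M₂ / z and κ_z ≤ κ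
  have hle : ∀ z : ℝ, 0 < z → κN z ≤ κ := by
    intro z hz
    rw [hκN]
    refine Finset.sum_le_sum fun m hm => ?_
    have h1 : z / (z + ℓ m) ≤ 1 := by
      rw [div_le_one (by linarith [hℓ m hm])]; linarith [hℓ m hm]
    have h0 : 0 ≤ w m * ℓ m := mul_nonneg (hw m hm) (hℓ m hm).le
    calc w m * ℓ m * (z / (z + ℓ m)) ≤ w m * ℓ m * 1 := mul_le_mul_of_nonneg_left h1 h0
      _ = w m * ℓ m := mul_one _
  have hdef : ∀ z : ℝ, 0 < z → κ - κN z ≤ M₂ / z := by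
    intro z hz
    have : κ - κN z = ∑ m ∈ S, w m * ℓ m * (ℓ m / (z + ℓ m)) := by
      rw [hκdef, hκN, ← Finset.sum_sub_distrib]
      refine Finset.sum_congr rfl fun m hm => ?_
      have h1 : z + ℓ m ≠ 0 := by linarith [hℓ m hm]
      field_simp
      ring
    rw [this, hM₂, Finset.sum_div]
    refine Finset.sum_le_sum fun m hm => ?_
    have hl := hℓ m hm; have hw' := hw m hm
    have hfrac : ℓ m / (z + ℓ m) ≤ ℓ m / z :=
      div_le_div_of_nonneg_left hl.le hz (by linarith)
    calc w m * ℓ m * (ℓ m / (z + ℓ m)) ≤ w m * ℓ m * (ℓ m / z) :=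
          mul_le_mul_of_nonneg_left hfrac (by positivity)
      _ = w m * ℓ m ^ 2 / z := by ring
  -- for z ≥ 2 M₂/κ: κ_z ≥ κ/2 and z/κ_z - z/κ ≤ 2 M₂/κ²
  have hhalf : ∀ z : ℝ, 0 < z → 2 * M₂ / κ ≤ z → κ / 2 ≤ κN z := by
    intro z hz hzl
    have h1 := hdef z hz
    have h2 : M₂ / z ≤ κ / 2 := by
      rw [div_le_iff₀ hz]
      rw [div_le_iff₀ hκ] at hzl
      linarith
    linarith
  have hexcess : ∀ z : ℝ, 0 < z → 2 * M₂ / κ ≤ z → z / κN z ≤ z / κ + 2 * M₂ / κ ^ 2 := by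
    intro z hz hzl
    have hkz : κ / 2 ≤ κN z := hhalf z hz hzl
    have hkz0 : 0 < κN z := by linarith
    have h1 := hdef z hz
    -- z/κ_z - z/κ = z (κ - κ_z)/(κ κ_z) ≤ z (M₂/z) / (κ · κ/2)
    have h2 : z / κN z - z / κ = z * (κ - κN z) / (κ * κN z) := by
      field_simp
    have h3 : z * (κ - κN z) / (κ * κN z) ≤ z * (M₂ / z) / (κ * (κ / 2)) := by
      have hnum : z * (κ - κN z) ≤ z * (M₂ / z) := mul_le_mul_of_nonneg_left h1 hz.le
      have hnum0 : 0 ≤ z * (M₂ / z) := by positivity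
      calc z * (κ - κN z) / (κ * κN z) ≤ z * (M₂ / z) / (κ * κN z) :=
            div_le_div_of_nonneg_right hnum (by positivity)
        _ ≤ z * (M₂ / z) / (κ * (κ / 2)) :=
            div_le_div_of_nonneg_left hnum0 (by positivity)
              (mul_le_mul_of_nonneg_left hkz hκ.le)
    have h4 : z * (M₂ / z) / (κ * (κ / 2)) = 2 * M₂ / κ ^ 2 := by
      field_simp
    linarith
  have hxy0 : 0 < x + y := by linarith
  have hxyl : 2 * M₂ / κ ≤ x + y := le_trans hx (by linarith)
  have hk3 : κ / 2 ≤ κN (x + y) := hhalf (x + y) hxy0 hxyl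
  have hk30 : 0 < κN (x + y) := by linarith
  have hlast : (x + y) / κ ≤ (x + y) / κN (x + y) :=
    div_le_div_of_nonneg_left hxy0.le hk30 (hle (x + y) hxy0)
  have e1 := hexcess x hx0 hx
  have e2 := hexcess y hy0 hy
  have hsplit : (x + y) / κ = x / κ + y / κ := by ring
  have hfinal : 4 * M₂ / κ ^ 2 = 2 * M₂ / κ ^ 2 + 2 * M₂ / κ ^ 2 := by ring
  linarith

/-! ## §1 Load-bearing analysis: the shell without dynamics is false -/

/-- The crux with ALL dynamical hypotheses (`hU` uniqueness, `hμ` steady-state family, `hD` the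
response link) dropped: bounded insertion cost for every positive sequence. -/
def WithoutDynamics : Prop :=
  ∀ D : ℕ → ℝ, (∀ N : ℕ, 2 ≤ N → 0 < D N) → InsertionBounded D

/-- **Any proof of (A) must use the dynamics**: the bare shell is false.  Witness
`D_N = (N-1)/(N + √N)` (`R_N = N + N^{1/2}`, positive response), killed by the power-law criterion.
(Same content as the one-shot refuter's evidence `Shell.lean`, re-derived from §2.) -/
theorem superadditiveResistance_false_without_dynamics : ¬ WithoutDynamics := by
  intro h
  set D : ℕ → ℝ := fun N => ((N : ℝ) - 1) / ((N : ℝ) + (N : ℝ) ^ (1 / 2 : ℝ)) with hD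
  have hpos : ∀ N : ℕ, 2 ≤ N → 0 < D N := by
    intro N hN
    have hN1 : (1 : ℝ) < N := by exact_mod_cast hN
    have hNs : (0 : ℝ) ≤ (N : ℝ) ^ (1 / 2 : ℝ) := Real.rpow_nonneg (by linarith) _
    exact div_pos (by linarith) (by linarith)
  refine not_insertionBounded_of_rpow_correction (D := D) 1 0 1 (1 / 2) one_pos (by norm_num)
    (by norm_num) ?_ (h D hpos)
  intro N hN
  have hN1 : (1 : ℝ) < N := by exact_mod_cast hN
  have hNs : (0 : ℝ) ≤ (N : ℝ) ^ (1 / 2 : ℝ) := Real.rpow_nonneg (by linarith) _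
  have hden : (N : ℝ) + (N : ℝ) ^ (1 / 2 : ℝ) ≠ 0 := by linarith
  have hnum : (N : ℝ) - 1 ≠ 0 := by linarith
  rw [hD]
  field_simp
  ring

/-! ## §3 Tightness at the harmonic corner (`lam = β = 0`, excluded by the crux but its limit point) -/

/-- **At the harmonic corner the insertion constant is at least the ballistic resistance.**  For
`pinnedChain ω₂ 0 0 γ` (`ω₂, γ > 0`) along the explicit Gaussian family `harmonicNESS ω₂ γ`: steady
states for all `N` and `T_L, T_R > 0`; for every `T > 0` the response limits exist and equal
`D_N = (N-1)·fluxCoeff ω₂ γ N` (so `R_N = 1/fluxCoeff ω₂ γ N` for `N ≥ 2`), `D_N > 0` for `N ≥ 2`,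
and for every `C < 1/fluxLimit ω₂ γ` the conclusion of (A) FAILS (`R_N + R_M - R_{N+M} → 1/c_∞` as
`N, M → ∞`, `tendsto_fluxCoeff`).  Since `1/fluxLimit ω₂ γ = 2(1+γ²)/(γ r) → ∞` as `ω₂ → ∞` or
`γ → 0, ∞`, no `(ω₂, γ)`-uniform constant survives near the corner.  (The corner itself satisfies
(A) with a larger constant — `R_N` is bounded there — which is the route's `HarmonicCalibration`.) -/
theorem harmonic_corner_constant_ge_ballistic_resistance {ω₂ γ : ℝ} (hω : 0 < ω₂) (hγ : 0 < γ) :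
    ∃ μ : (N : ℕ) → ℝ → ℝ → Measure (PhaseSpace N),
      (∀ (N : ℕ) (T_L T_R : ℝ), 0 < T_L → 0 < T_R →
          (pinnedChain ω₂ 0 0 γ).IsSteadyState N T_L T_R (μ N T_L T_R)) ∧
      ∀ T : ℝ, 0 < T → ∃ D : ℕ → ℝ,
        (∀ N : ℕ, Tendsto (fun δ : ℝ =>
            (pinnedChain ω₂ 0 0 γ).totalCurrent (μ N (T + δ / 2) (T - δ / 2)) / δ)
          (𝓝[≠] 0) (𝓝 (D N))) ∧
        (∀ N : ℕ, D N = ((N : ℝ) - 1) * fluxCoeff ω₂ γ N) ∧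
        (∀ N : ℕ, 2 ≤ N → 0 < D N) ∧
        ∀ C : ℝ, C < 1 / fluxLimit ω₂ γ →
          ¬ ∀ N M : ℕ, 2 ≤ N → 2 ≤ M →
            ((N : ℝ) - 1) / D N + ((M : ℝ) - 1) / D M - C ≤ ((N : ℝ) + (M : ℝ) - 1) / D (N + M) := by
  set P := pinnedChain ω₂ 0 0 γ with hP
  refine ⟨fun N a b => harmonicNESS ω₂ γ N a b,
    fun N T_L T_R hL hR => isSteadyState_harmonicNESS hω hγ N hL hR, fun T hT => ?_⟩
  set D : ℕ → ℝ := fun N => ((N : ℝ) - 1) * fluxCoeff ω₂ γ N with hDdef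
  have hcpos : ∀ N : ℕ, 2 ≤ N → 0 < fluxCoeff ω₂ γ N := by
    intro N hN
    rw [fluxCoeff_eq hω hγ (show 1 < N by omega)]
    have hr := rootR_pos hω hγ
    positivity
  refine ⟨D, fun N => ?_, fun N => rfl, fun N hN => ?_, fun C hC => ?_⟩
  · -- the response limit along the Gaussian family
    cases N with
    | zero =>
      have h0 : D 0 = 0 := by simp [hDdef, fluxCoeff]
      rw [h0]
      refine (tendsto_const_nhds (x := (0 : ℝ))).congr' ?_
      filter_upwards with δ
      simp [OscillatorChain.totalCurrent_zero]
    | succ M =>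
      have hconst : ∀ᶠ δ in 𝓝[≠] (0 : ℝ),
          P.totalCurrent (harmonicNESS ω₂ γ (M + 1) (T + δ / 2) (T - δ / 2)) / δ = D (M + 1) := by
        have h2 : ∀ᶠ δ in 𝓝 (0 : ℝ), δ < 2 * T := eventually_lt_nhds (by linarith)
        have h2' : ∀ᶠ δ in 𝓝 (0 : ℝ), -(2 * T) < δ := eventually_gt_nhds (by linarith)
        have hne : ∀ᶠ δ in 𝓝[≠] (0 : ℝ), δ ≠ 0 := eventually_mem_nhdsWithin
        filter_upwards [mem_nhdsWithin_of_mem_nhds h2, mem_nhdsWithin_of_mem_nhds h2', hne]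
          with δ hlt hgt hδ
        have ha : 0 < T + δ / 2 := by linarith
        have hb : 0 < T - δ / 2 := by linarith
        rw [P.totalCurrent_eq_of_forall _ (fluxCoeff ω₂ γ (M + 1) * δ)]
        · simp only [hDdef]; push_cast; field_simp; ring
        · intro i hi
          rw [hP, integral_bondCurrent_harmonicNESS_eq_fluxCoeff' hω hγ ha hb i hi]
          ring
      exact (tendsto_const_nhds).congr' (hconst.mono fun δ hδ => hδ.symm)
  · -- positivity for `N ≥ 2`
    have h1 : (1 : ℝ) < N := by exact_mod_cast hN
    have := hcpos N hN
    simp only [hDdef]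
    exact mul_pos (by linarith) this
  · -- the defect tends to the ballistic resistance `1/c_∞ > C`
    intro hall
    have hR : ∀ N : ℕ, 2 ≤ N → ((N : ℝ) - 1) / D N = (fluxCoeff ω₂ γ N)⁻¹ := by
      intro N hN
      have h1 : (N : ℝ) - 1 ≠ 0 := by
        have : (1 : ℝ) < N := by exact_mod_cast hN
        linarith
      simp only [hDdef]
      rw [div_mul_eq_div_div, div_self h1, one_div]
    have hlim : Tendsto (fun N : ℕ => (fluxCoeff ω₂ γ N)⁻¹) atTop (𝓝 (fluxLimit ω₂ γ)⁻¹) :=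
      (tendsto_fluxCoeff hω hγ).inv₀ (fluxLimit_pos hω hγ).ne'
    have hCinv : C < (fluxLimit ω₂ γ)⁻¹ := by rwa [one_div] at hC
    set ε : ℝ := ((fluxLimit ω₂ γ)⁻¹ - C) / 4 with hε
    have hεpos : 0 < ε := by rw [hε]; linarith
    have hev : ∀ᶠ N : ℕ in atTop,
        (fluxLimit ω₂ γ)⁻¹ - ε < (fluxCoeff ω₂ γ N)⁻¹ ∧ (fluxCoeff ω₂ γ N)⁻¹ < (fluxLimit ω₂ γ)⁻¹ + ε :=
      hlim.eventually (Ioo_mem_nhds (by linarith) (by linarith))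
    obtain ⟨N₀, hN₀⟩ := eventually_atTop.mp hev
    set N := max N₀ 2 with hNdef
    have hN2 : 2 ≤ N := le_max_right _ _
    have hN0 : N₀ ≤ N := le_max_left _ _
    have hNN : 2 ≤ N + N := by omega
    have hlow := (hN₀ N hN0).1
    have hup := (hN₀ (N + N) (by omega)).2
    have key := hall N N hN2 hN2
    have h3 : ((N : ℝ) + (N : ℝ) - 1) / D (N + N) = (fluxCoeff ω₂ γ (N + N))⁻¹ := by
      rw [← hR (N + N) hNN]; push_cast; ring
    rw [hR N hN2, h3] at key
    linarith

/-- In particular PURE superadditivity (`C = 0`) fails at the harmonic corner. -/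
theorem harmonic_corner_not_superadditive {ω₂ γ : ℝ} (hω : 0 < ω₂) (hγ : 0 < γ) :
    ∃ μ : (N : ℕ) → ℝ → ℝ → Measure (PhaseSpace N),
      (∀ (N : ℕ) (T_L T_R : ℝ), 0 < T_L → 0 < T_R →
          (pinnedChain ω₂ 0 0 γ).IsSteadyState N T_L T_R (μ N T_L T_R)) ∧
      ∀ T : ℝ, 0 < T → ∃ D : ℕ → ℝ,
        (∀ N : ℕ, Tendsto (fun δ : ℝ =>
            (pinnedChain ω₂ 0 0 γ).totalCurrent (μ N (T + δ / 2) (T - δ / 2)) / δ)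
          (𝓝[≠] 0) (𝓝 (D N))) ∧
        (∀ N : ℕ, 2 ≤ N → 0 < D N) ∧
        ¬ ∀ N M : ℕ, 2 ≤ N → 2 ≤ M →
            ((N : ℝ) - 1) / D N + ((M : ℝ) - 1) / D M ≤ ((N : ℝ) + (M : ℝ) - 1) / D (N + M) := by
  obtain ⟨μ, hμ, h⟩ := harmonic_corner_constant_ge_ballistic_resistance hω hγ
  refine ⟨μ, hμ, fun T hT => ?_⟩
  obtain ⟨D, hD, -, hpos, hC⟩ := h T hT
  refine ⟨D, hD, hpos, fun hall => hC 0 (by simpa using fluxLimit_pos hω hγ) ?_⟩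
  intro N M hN hM
  simpa using hall N M hN hM

/-! ## §4 Why it resists -/

/-- **WHY IT RESISTS** (prose record; the statement below is a triviality whose docstring is the
payload — provers and planners read this file).

(i) FAITHFUL FORMALISATION, NO JUNK HANDLE.  Read-back `superadditiveResistance_iff` is `Iff.rfl`;
casts explicit, `N + M` in `ℕ`, denominators `D_N > 0` on the guarded range `N, M ≥ 2` (no `x/0`);
`N = 0, 1` carry `totalCurrent ≡ 0` so `D_0 = D_1 = 0` is forced and excluded from the conclusion;
`(N-1)/D_N = δT/J̃ = 1/G_N` is the genuine end-to-end resistance (last `Fin N` summand of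
`totalCurrent` vanishes); the two-sided `δ`-limit is harmless (the chain is left-right symmetric,
`J` odd in `δ`); `hμ` constrains the family only at positive temperatures, which is all the limit
sees (`|δ| < 2T` eventually).  Degenerate instances of the conclusion's shell are all in §1–§2.

(ii) VACUITY STRUCTURE.  `hU` (weak-NESS uniqueness, item 0741), the existence of the response limit
(`hD` is an implication FROM a limit statement, item 0717) and `hpos` (item 11750) are fixed-`N`
theorems-in-waiting (CEHR 2018 Thm 2.13 + FP-identification; Rey-Bellet 2003 Rem 4.4; EPR 1999b):
TRUE in print for `lam, β > 0`, unproved in the tree.  If any of them were FALSE the crux would be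
VACUOUSLY TRUE (no refutation handle): dropping `hU` does not help the adversary either, because a
counterexample family `μ` must still consist of genuine steady states whose response we cannot
evaluate.  So `¬(A)` requires: the full fixed-`N` package AND a theorem `2R_N - R_{2N} → +∞` about
the TRUE linear response of a pinned doubly-anharmonic chain — an anomalous finite-size LOWER bound.
"Nothing is known about the dependence of `D` on `L`" (BLR 2000 §6.3; barrier
`FixedLengthNoConductivityControl`): no such theorem exists for any deterministic anharmonic chain,
in either direction.

(iii) PHYSICS CHECK (heuristic, not rigorous, not a computation of this seat).  In a
Peierls–Boltzmann slab picture `G_N ≈ ∫ w(k) dk/(1 + N/ℓ(k))` (`w ∝ |v(k)|`, `ℓ = v/ν` the mean free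
path), `R_N = N/κ + O(1)` iff `∫ w ℓ² < ∞`, and (A) fails (logarithmically or worse) iff the
`w`-second moment of `ℓ` diverges while `κ = ∫ w ℓ < ∞`.  STRUCTURAL INPUT (exact, in tree): the
interaction forces cancel in the total force (`OscillatorChain.sum_dPotential`, action–reaction), so
for `lam = 0` the centre of mass of `pinnedChain ω₂ 0 β γ` is an EXACT harmonic oscillator of
frequency `√ω₂`, damped/driven only through the two bath momenta
(`pinnedChain_sum_dPotential_harmonic`, CEHR 2018 §5.2 (5.16)); equivalently the anharmonic force on
the Fourier mode `k` coming from `V` carries the factor `e^{ik} - 1`, so its damping rate is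
`ν(k) = O(k²)` at EVERY order in `β` and every `T`, while `v(k) = sin k/ω(k) ≍ k/√ω₂`: at the EDGE
`lam = 0` (FPU-β interaction + harmonic pinning — outside the crux's open box, on its boundary) the
long waves have UNBOUNDED mean free path `ℓ(k) ≍ 1/k`, `κ = ∫ w ℓ < ∞` (normal conductivity) but
`∫ w ℓ² = ∫ dk/k = ∞`: the Knudsen layers of the modes `1/N < k < 1` cost `Σ_k κ_k ℓ_k/N ≍ (log N)/N`
of conductivity, whence `R_N ≈ N/κ + (c/κ²) log N` and (A) fails there by
`not_insertionBounded_of_log_correction` (near-miss `lam_zero_edge_log_anomaly`, §5); including the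
vanishing contact transmission of slow waves into a white Langevin bath — for the pinned harmonic
chain with friction `γ` on the end site an elementary reflection computation (this seat) gives
`𝒯(k) = 4γ ω(k) sin k/((1 - cos k)² + (sin k + γ ω(k))²) ≈ 4k/(γ√ω₂)` as `k → 0` — makes it worse:
entry length `ℓ/𝒯 ≍ k⁻²`, the channels with `k ≲ N^{-1/2}` are missing at length `N`, and
`R_N - N/κ ≍ N^{1/2}` (`not_insertionBounded_of_rpow_correction`, `s = 1/2`).  For `lam > 0`
the on-site quartic force `lam q³` couples the mode `k` WITHOUT the factor `e^{ik} - 1`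
(vertex `lam ∏(2ω_i)^{-1/2}`), and non-trivial 4-phonon resonances through `k₁ = 0` exist (branch
`cos d₁₂ + cos d₃₄ = Σ² cos s/(2 sin² s)` for `ω² = (ω₂+2) - 2cos k`, a window of partners `k₂`
around `π`, passing through the trivial point at `(k₁, k₂) = (0, π)`), so `ν(0) > 0`, `ℓ` is BOUNDED
(`ℓ(k) → 0` at `k = 0, π`; entry lengths `ℓ/𝒯` bounded) and (A) is consistent, with
`C ≈ κ⁻² ∫ v ℓ²/𝒯 dk`, which grows like a power of `1/(lam T)` as `lam T → 0`.  CONSEQUENCE FOR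
PROVERS: the `1/N`-rate content of (A) must use the ON-SITE anharmonicity `lam > 0` quantitatively
(scattering of long waves), not merely pinning `ω₂ > 0` or interaction anharmonicity `β > 0`; and
`C(ω₂, lam, β, γ, T)` cannot be uniform as `lam T → 0` — allowed by the crux, which lets `C` depend
on all parameters, but fatal for any junction-repair lemma with a parameter-free constant.

(iv) HARMONIC CORNER (rigorous, §3): `C ≥ 1/fluxLimit ω₂ γ` is forced along `harmonicNESS`;
transfer to small `(lam, β) > 0` needs continuity of the fixed-`N` response in the couplings
(expected from the fixed-`N` theory, not in the tree) — near-miss `corner_transfer` in §5.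

(v) LOW TEMPERATURE.  By the exact scaling `D_N(T; lam, β) = D_N(1; lam T, β T)` (barrier
`LowTemperatureWeakAnharmonicity`), `T → 0` at fixed couplings is the corner again: (iv) gives
`liminf_{T→0} C(T) ≥ 1/fluxLimit ω₂ γ` (granted continuity) and (iii) suggests `C(T) ≳ log(1/(lam T))`;
a gray (single mean-free-path) estimate gives defect `→ ℓ/κ = 1/c_∞`, so the card's fear
"`C(T) ↑ ∞` as `T → 0`" is at worst logarithmic in this picture — no kill.

(vi) NUMERICS.  For the crux's own chain the defect is `O(1)` while `R_N = O(N)`: telling `log N` from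
bounded needs relative precision `≪ 1/N` on each NESS current at `N ≳ 10²`; with current
autocorrelation time `τ = O(1–10)` and `Var(J_inst) = O(N T²)` an NEMD run needs `t ≳ 10⁸–10⁹` time
units per size — not a cheap probe, and log-vs-bounded is undecidable at accessible `N` anyway (the
one-shot refuter's `j003758` reading rule stands).  WHAT IS CHEAP AND EXACT: second-moment-closed
PROXIES — the pinned harmonic chain between the same Langevin baths with an energy-conserving bulk
noise, whose stationary covariance solves a finite linear system (no sampling): velocity-flip noise
(every mode damped at rate `≍ λ`: bounded mean free path, the `lam > 0` caricature) versus
momentum-EXCHANGE noise (mode `k` damped at rate `≍ λk²` with `v ≍ k`: unbounded `ℓ ≍ 1/k` with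
finite `κ` thanks to pinning, Basile–Bernardin–Olla — exactly the structure of the `lam = 0` edge in
(iii)).  Jobs `j013120` (`N ≤ 256`) and `j013131` (`N ∈ {256, 384, 512}`) of this seat
(`proxy_insertion.py`: GMRES with an exact Lyapunov preconditioner, sparse-direct cross-check,
regression of the noiseless case against the tree's closed form `fluxCoeff`; doubling defects
`Δ_N = 2R_N - R_{2N}`); prediction: `Δ_N` saturates for flips (as in the printed affine law
`κ_L = a'L/(b' + λL)` for velocity-rotation noise, Landi–de Oliveira 2014, arXiv:1309.6560 §IV) and
grows like `√N` (×1.41 per doubling, from the `k ≲ N^{-1/2}` missing channels) for exchanges.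
Results: §6.

(vii) LITERATURE / NEGATIVES.  `ledger negatives --problem AtomisticToContinuum` (11): none touches
this decl or its shell.  Barriers: `FPUBetaKineticAnomaly` (unpinned: (A) fails like `N^{2/5}`-type
power laws — evaded by `ω₂ > 0`), `HarmonicChainBallisticFlux` ((A) true, §3 quantifies the
constant), `LowTemperatureWeakAnharmonicity` ((v)), `MazurBoundBallistic` (ballistic ⇒ (A) true),
`FixedLengthNoConductivityControl` ((ii)), `StrongPinningBreathers` (concerns `β = 0`, pinning
degree > coupling degree: not the crux's chain, and about relaxation rates, not finite-size NESS
laws).  Printed numerics on the `lam > 0` side are (A)-consistent and in fact two-sided-local: for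
the `φ⁴` chain (on-site quartic, `β = 0`) the boundary jumps obey `T_i - T_i⁰ = η ∂T/∂x` with
`η = ακ(T)`, `α = 2.6(1)`, i.e. `R_N ≈ (N + 2η)/κ` AFFINE (Aoki–Kusnezov 2000, Phys. Lett. A 265,
arXiv:chao-dyn/9910015, eqs. (11)–(12) and Fig. 5; Lepri–Livi–Politi 2003 §6).  No printed
finite-size theorem or counterexample for a pinned anharmonic chain's NESS resistance exists
(grounder g21-20; Lepri (ed.) LNP 921 Ch. 5; BLR 2000 §6.3).  Literature services were degraded in
this session (searchd rc 75, OpenAlex/arXiv 429): the `lam = 0`-edge prediction of (iii) (finite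
`κ` with `(log N)/N` or `N^{-1/2}` finite-size corrections for FPU-β + harmonic pinning) could not
be checked against printed numerics — open question for the next cycle. -/
theorem why_it_resists : True := trivial

/-! ## §5 Near-misses (conjectural signatures; `sorry` permitted ONLY here, obstruction documented) -/

/-- NEAR-MISS 1 (corner transfer).  CLAIM: for all `ω₂, γ, T > 0` and every `C < 1/fluxLimit ω₂ γ`
there are `lam, β > 0` (small) such that, under the crux's hypotheses for `pinnedChain ω₂ lam β γ`,
the conclusion of (A) fails WITH THAT `C` — i.e. `C(ω₂, ·, ·, γ, T)` is not bounded by anything below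
the ballistic resistance near the corner.  OBSTRUCTION: needs continuity of the fixed-`N` response
`D_N(T; lam, β)` at `(lam, β) = (0, 0)` for two fixed lengths `N, 2N` (perturbation theory of the
hypoelliptic NESS in the couplings: Rey-Bellet 2003 Rem 4.4 / Hairer–Majda 2009 framework), absent
from the tree; with it the proof is §3 plus an `ε/3` argument.  Not a refutation of the crux (which
lets `C` depend on `lam, β`), but the quantitative boundary behaviour any junction-repair lemma must
reproduce.  Tried: nothing beyond locating the missing continuity statement. -/
theorem corner_transfer {ω₂ γ : ℝ} (hω : 0 < ω₂) (hγ : 0 < γ) (T C : ℝ) (hT : 0 < T)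
    (hC : C < 1 / fluxLimit ω₂ γ) :
    ∃ lam β : ℝ, 0 < lam ∧ 0 < β ∧
      ∀ μ : (N : ℕ) → ℝ → ℝ → Measure (PhaseSpace N),
        (∀ (N : ℕ) (T_L T_R : ℝ), 0 < T_L → 0 < T_R →
          (pinnedChain ω₂ lam β γ).IsSteadyState N T_L T_R (μ N T_L T_R)) →
        ∀ D : ℕ → ℝ,
          (∀ N : ℕ, Tendsto (fun δ : ℝ =>
              (pinnedChain ω₂ lam β γ).totalCurrent (μ N (T + δ / 2) (T - δ / 2)) / δ)
            (𝓝[≠] 0) (𝓝 (D N))) →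
          (∀ N : ℕ, 2 ≤ N → 0 < D N) →
          ¬ ∀ N M : ℕ, 2 ≤ N → 2 ≤ M →
            ((N : ℝ) - 1) / D N + ((M : ℝ) - 1) / D M - C ≤ ((N : ℝ) + (M : ℝ) - 1) / D (N + M) := by
  sorry

/-- NEAR-MISS 2 (the `lam = 0` edge; heuristic of §4 (iii)).  CLAIM: for the pinned FPU-β chain
`pinnedChain ω₂ 0 β γ` (`ω₂, β, γ, T > 0`; NOT a member of the crux's family, which has `lam > 0`)
the insertion cost is UNBOUNDED along any steady-state family with response `D`:
`2R_N - R_{2N} → +∞` (like `log N`).  MECHANISM (exact part, in tree): action–reaction makes the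
centre of mass an exact harmonic oscillator for `lam = 0` (`pinnedChain_sum_dPotential_harmonic`),
so long waves decouple from the anharmonic interaction at rate `O(k²)` while moving at speed `≍ k`:
mean free path `≍ 1/k`, conductivity finite, finite-size correction `≍ (log N)/N` (Knudsen
layers) or `N^{-1/2}` (with the vanishing contact transmission of slow waves) instead of `1/N`.
OBSTRUCTION: no kinetic-to-NESS transfer (not even the existence of `D_N`, nor a Boltzmann-level
finite-slab theorem) exists for any anharmonic chain; the heuristic slab rule `G_N ≈ ∫ w/(1 + N/ℓ)`
is itself unjustified.  Recorded because it identifies WHICH hypothesis (`lam > 0`) the `1/N` rate in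
(A) leans on, and predicts `C ≳ κ⁻² log(1/(lam T))`.  STATUS: the mechanism is CONFIRMED in the
exact Gaussian proxy (§6: momentum-exchange noise, `Δ_N` growing without saturation to `N = 64`,
versus exactly affine `R_N` for flip noise); for the deterministic chain it stays heuristic.  Tried: vertex/resonance analysis by hand; no
certified computation (an NEMD test of `2R_N - R_{2N}` at `lam = 0` vs `lam = 1` would need the
precision discussed in §4 (vi)). -/
theorem lam_zero_edge_log_anomaly {ω₂ β γ : ℝ} (hω : 0 < ω₂) (hβ : 0 < β) (hγ : 0 < γ) (T : ℝ)
    (hT : 0 < T) (μ : (N : ℕ) → ℝ → ℝ → Measure (PhaseSpace N))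
    (hμ : ∀ (N : ℕ) (T_L T_R : ℝ), 0 < T_L → 0 < T_R →
      (pinnedChain ω₂ 0 β γ).IsSteadyState N T_L T_R (μ N T_L T_R))
    (D : ℕ → ℝ)
    (hD : ∀ N : ℕ, Tendsto (fun δ : ℝ =>
        (pinnedChain ω₂ 0 β γ).totalCurrent (μ N (T + δ / 2) (T - δ / 2)) / δ)
      (𝓝[≠] 0) (𝓝 (D N)))
    (hpos : ∀ N : ℕ, 2 ≤ N → 0 < D N) :
    Tendsto (fun N : ℕ => 2 * (((N : ℝ) - 1) / D N) - ((N : ℝ) + (N : ℝ) - 1) / D (N + N))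
      atTop atTop := by
  sorry

/-! ## §6 Proxy computation (exact second-moment NESS; jobs j013120 done, j014402 pending) -/

/-- **PROXY RESULTS** (job `j013120`, `proxy_insertion.py`, `ω₂ = γ = λ = 1`, `T_L - T_R = 1`; exact
linear algebra, residuals `≤ 1e-11`, sparse-direct cross-check `≤ 2e-9` for `N ≤ 64`; evidence
`j013120` on the item).  `R_N := 1/J_N` (= the crux's `(N-1)/D_N` for these linear models),
`Δ_N := 2R_N - R_{2N}`.

* `none` (ballistic pinned harmonic chain): `R_N → 8.0000000 = 1/fluxLimit 1 1` from `N = 16` on,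
  relative error to the tree's closed form `fluxCoeff_eq` `≤ 1.4e-13` (REGRESSION PASSED); `Δ_N → 8`
  (= the ballistic resistance, cf. §3).
* `flip` (velocity flips, rate 1; bounded mean free path — the `lam > 0` caricature):
  `R_N = 10.4721360·N - 6.0236670` AFFINE for `N ≥ 12` to `4e-8` (log / √N / 1/N coefficients fit to
  `< 1e-7`); `Δ_N = -6.02367` constant for `12 ≤ N ≤ 128`.  (A) HOLDS in this proxy (even with a
  negative constant: two-sided locality), matching the printed affine law for momentum-non-conserving
  noise (Landi–de Oliveira 2014).
* `exchange` (momentum exchange, rate 1; `k²`-damped slow waves, mean free path `≍ 1/k`, finite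
  `κ ≈ 1/1.236` — the `lam = 0`-edge caricature), `N ≤ 128` (the 0.5 h lane limit cut the run):
  `R_N` = 6.470, 9.309, 12.056, 17.406, 22.651, 32.987, 43.208, 63.473, 83.607, 123.679, 163.608 for
  `N` = 4, 6, 8, 12, 16, 24, 32, 48, 64, 96, 128;
  `Δ_N` = 0.884, 1.212, 1.460, 1.824, 2.095, 2.501, 2.808, 3.266, 3.607 for `N` = 4 … 64, with
  INCREASING increments per doubling (0.577, 0.635, 0.713, 0.799) — no saturation; best fits
  `R_N ≈ 1.236·N + 1.3·log N + O(1) + O(1/N)` (max residual `1e-4` on `N ≥ 32`) with an emerging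
  `√N` component (coefficient `0.05–0.2`, the contact-limited channels of §4 (iii)).  (A) FAILS in
  this proxy: the insertion cost is unbounded (at least logarithmically), exactly as predicted from
  `slab_doubling_defect_ge` with `ℓ(k) ≍ 1/k`.  LARGER SIZES (jobs `j014402`, `j014949`, exact):
  `R_192 = 243.25182`, `R_256 = 322.74461`, `R_384 = 481.50754`, hence `Δ_96 = 4.106`, `Δ_128 = 4.471`,
  `Δ_192 = 4.996`; along `N = 6·2^k` the increments per doubling are 0.612, 0.677, 0.765, 0.840, 0.890 —
  still increasing at `N = 192`: super-logarithmic growth, consistent with `a + b log N + c√N`, small `c`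
  (the contact-limited `√N` channel of §4 (iii)); either law kills (A) by §2 (`R_512` pending in `j014949`).

READING.  Same chain, same baths, same pinning, same (finite) conductivity scale; the ONLY difference
between `flip` and `exchange` is whether long waves are scattered at a rate bounded below (`flip`:
yes ⇒ affine `R_N`, (A) true) or at rate `≍ k²` (`exchange`: unbounded mean free path ⇒ (A) false).
For the crux this is the sharpest available statement of WHAT a proof must use: the on-site
anharmonicity `lam > 0` as a lower bound on the scattering of long waves (in `pinnedChain ω₂ 0 β γ`
action–reaction forbids it, §4 (iii)); the pinning `ω₂ > 0` and the interaction anharmonicity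
`β > 0` alone do not give bounded insertion cost in the caricature. -/
theorem proxy_results : True := trivial

/-! ## §7 Line `floating-probe-bypass-laplacian` (lead b, skeleton v2/v3) — stub audit of this seat

READ-BACK of `Lines/floating_probe_bypass_laplacian.lean` (2026-08-16T05:20Z): seven stubs, composition
`SuperadditiveResistance_of` kernel-checked (joint sufficiency is not in question); `C := 2C₁ + 2max(C₃,0) + C₂`.
Fixed-`N` stubs S0a/S0b (existence of `C² ∩ L²(μ_T)` forward fields: true in print — `g = ∫₀^∞ P_t f dt` with
CEHR's `e^{θH}`-weighted exponential convergence, `2θ < 1/T`, and Hörmander smoothness), S0c (Kubo link — the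
ONLY place the crux's `D` enters; its normalisation is CALIBRATED below at the harmonic `L = 2` point against the
tree's `fluxCoeff`), S0d (Kubo–Onsager, held/proved by the lead).  The bets S1 (termination locality, one-sided,
division-free), S2 (bypass bound `x ≤ C₃ab`), S3 (probe-removal cost, HARDEST) are crux-strength `N`-uniform
statements: no finite witness is possible inside the box (`lam, β > 0` are hypotheses of each), exactly as for
the crux.  Junk audit: `termSite` uses `ℕ`-subtraction but `N, M ≥ 2` guard it (sites `0, N−1, N, N+M−1`
distinct and `< N+M`); the divisions `1/floatingConductance`, `1/plainKubo` in S3 are not guarded inside S3 —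
`G_dev > 0` follows from `stub_kuboOnsager` + `laplacian_pos`, but `plainKubo gL > 0` for the bare `(N+M)`-chain
is available only through the crux's `D > 0` and S0c (as the composition does), not from S3's own hypotheses: a
prover of S3 must either carry the two-terminal Kubo–Onsager positivity or accept the junk case (which only makes
S3 harder, never vacuous).  EDGE BED: job `j014552` (this seat, `device_legs.py`) computes the four legs
`leg1N = R_N − 1/a`, `leg1M`, `leg2 = x/(ab)`, `leg3 = 1/G_dev − R_{N+M}` EXACTLY in the flip / exchange proxies
(`L ≤ 256`, splits `N = L/2, L/4`); reading rule: a leg unbounded already under flip noise (bounded mean free path)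
would be a genuine alarm for the corresponding stub; under exchange noise the total defect diverges (§6) and the
table shows which stub carries the edge divergence.  RESULTS: `line_fpbl_legs_bed` below. -/
theorem line_fpbl_audit : True := trivial

/-- **LEGS BED RESULTS** (job `j014552`, `device_legs.py`, exact Woodbury solver self-tested against dense
solves to `3e-14`; `ω₂ = γ = λ = 1`; device response matrices symmetric to `1e-15`, zero row sums to `7e-13`;
evidence `j014552` on the item).  Legs of `SuperadditiveResistance_of` for the splits `N = M = L/2`
(the `N = L/4` splits behave the same):

FLIP noise (bounded mean free path) — EVERY LEG IS A CONSTANT in `L` (to 5 digits from `L = 24` on):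
`leg1N = leg1M = −1.93762` (termination: the device's clamped self-conductance is SMALLER than `G_N`, so S1
holds with any `C₁ ≥ 0`), `leg2 = x/(ab) = 0.16019` (S2 with `C₃ = 0.1602`), `legS = 0.32033`
(`≤ 2C₃ = 0.3204`: `series_defect_le` is TIGHT here), `leg3 = −2.46876` (S3 with any `C₂ ≥ −2.468`);
total `−6.02367 = Δ` of §6.  All three bets hold with explicit constants in the bounded-mfp proxy.

EXCHANGE noise (`k²`-damped slow waves, the `lam = 0`-edge structure) — `L = 8 … 256`:
`leg1N, leg1M`: 0.117, 0.098, 0.084, 0.064, 0.049, 0.030, 0.019, 0.005, −0.002, −0.010 (`→ 0⁻`, BOUNDED: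
termination locality S1 survives the edge); `leg2 = x/(ab)`: 0.283 → 0.2992 (constant: the bypass bound S2
survives the edge, `C₃ ≈ 0.30`); `legS → 0.597 ≈ 2C₃` (tight again); `leg3 = 1/G_dev − R_{N+M}`:
0.108, 0.457, 0.722, 1.116, 1.411, 1.850, 2.178, 2.660, 3.015, 3.530 for `N = M` = 4, 6, 8, 12, 16, 24,
32, 48, 64, 96 — UNBOUNDED, increments per doubling of `L` growing (0.61, 0.69, 0.77, 0.84): the probe-removal
cost S3 carries the ENTIRE edge divergence of the defect (§6).

READING FOR THE LEAD.  (i) No stub is false in either bed (no alarm).  (ii) S1 (`stub_terminationLocality`)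
and S2 (`stub_bypassBound`) are insensitive to the mean-free-path spectrum — they hold even with unbounded
mfp and finite `κ` — so "soft" arguments (renewal at a bathed site, one transmission factor per block) of the
kind the card proposes are the right size; they should NOT need `lam > 0` quantitatively.  (iii) S3
(`stub_probeRemovalCost`) is exactly the statistic `Σ w ℓ²` of §2b: bounded iff long waves are scattered; its
proof must use the on-site anharmonicity `lam > 0` as a lower bound on the damping of long waves (at `lam = 0`
action–reaction forbids it, §4 (iii)), and any engine that is blind to the mfp spectrum (fixed-`N` resolvent
identities, smoothing, parity) cannot close it alone.  (iv) Calibration targets for a future quantitative S3: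
flip `C₂ = −2.469` (probe insertion LOWERS the resistance when the mfp is bounded and short), exchange
`C₂(L) ≈ 0.9·log L − 1.2` and growing faster than `log`. -/
theorem line_fpbl_legs_bed : True := trivial

/-- **Calibration of `stub_plainKuboLink` (S0c) at the harmonic point `(ω₂, γ, L) = (1, 1, 2)`, any `T`.**
For the pinned HARMONIC 2-chain (`lam = β = 0`: outside S0c's hypotheses, but the normalisation of the Kubo
formula does not see the anharmonicity) the equilibrium generator is `L = (Ax)·∇ + γT(∂²_{p₀} + ∂²_{p₁})`
with the drift `A2` below (coordinates `(q₀, q₁, p₀, p₁)`, `K = [[2,−1],[−1,2]]`, friction `1` on both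
sites), and the quadratic `g(x) = xᵀQx − tr(QΣ_T)` with `Q = P2/12` solves the forward-field equation
`L g = −(p₀² − T)` iff `QA + AᵀQ = −E` (`E = e_{p₀}e_{p₀}ᵀ`) and `2γT(Q_{p₀p₀} + Q_{p₁p₁}) = T`; both hold
(first and third conjuncts, over `ℤ` after scaling by `12`).  By the Gaussian covariance identity
`Cov_{μ_T}(xᵀQx, p₀²) = 2 tr(QΣEΣ) = 2T²Q_{p₀p₀}` (`Σ = T·diag(K⁻¹, I)`), the stub's right-hand side is
`plainKubo = γ(1 − (γ/T²)·2T²Q_{p₀p₀}) = 1 − 2·(5/12) = 1/6` (fourth conjunct), which IS the tree's exact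
two-site flux coefficient `fluxCoeff 1 1 2 = 1/6` (`fluxCoeff_one_one_two` below) `= D₂/(2−1)` along the
harmonic family.  So the sign of the `g`-term, the powers of `γ` and of `T`, and the `(L−1)` normalisation in
S0c are RIGHT (a misstated Kubo link would have silently mis-scaled every leg).  Informal steps not formalised:
the Isserlis identity under `gibbsMeasure` and membership of the quadratic `g` in `plainForwardFields`. -/
def A2 : Matrix (Fin 4) (Fin 4) ℤ := !![0, 0, 1, 0; 0, 0, 0, 1; -2, 1, -1, 0; 1, -2, 0, -1]

/-- `P2 = 12 • Q`, `Q` the matrix of the quadratic left forward field of the harmonic 2-chain (see `A2`). -/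
def P2 : Matrix (Fin 4) (Fin 4) ℤ := !![9, -3, -1, -2; -3, 3, 2, 1; -1, 2, 5, 0; -2, 1, 0, 1]

/-- The source matrix of `p₀²` (see `A2`). -/
def E2 : Matrix (Fin 4) (Fin 4) ℤ := !![0, 0, 0, 0; 0, 0, 0, 0; 0, 0, 1, 0; 0, 0, 0, 0]

/-- The calibration identities (see `A2`): Lyapunov-type equation, symmetry, constant term, and the value
`γ(1 − 2γ Q_{p₀p₀}) = 1/6`. -/
theorem kuboLink_calibration_L2 :
    P2 * A2 + A2.transpose * P2 = -(12 • E2) ∧ P2.transpose = P2 ∧ 2 * (P2 2 2 + P2 3 3) = 12 ∧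
      (1 : ℚ) - 2 * (5 / 12) = 1 / 6 := by
  refine ⟨by decide, by decide, by decide, by norm_num⟩

/-- The tree's exact two-site flux coefficient at `ω₂ = γ = 1`: `fluxCoeff 1 1 2 = 1/6`
(`rootR 1 1 = 1/2`), the value reproduced by the Kubo link's right-hand side in `kuboLink_calibration_L2`. -/
theorem fluxCoeff_one_one_two : fluxCoeff 1 1 2 = 1 / 6 := by
  rw [fluxCoeff_eq one_pos one_pos (by norm_num : 1 < 2)]
  have hs : Real.sqrt (lamb 1 1 + lamb 1 1 ^ 2 / 4) = 3 / 4 := by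
    rw [show lamb 1 1 + lamb 1 1 ^ 2 / 4 = (3 / 4 : ℝ) ^ 2 by unfold lamb; norm_num]
    exact Real.sqrt_sq (by norm_num)
  have hr : rootR 1 1 = 1 / 2 := by
    unfold rootR
    rw [hs]
    unfold lamb
    norm_num
  rw [hr]
  norm_num

end Summit.AtomisticToContinuum.FouriersLaw.Cruxes.SuperadditiveResistance.Disproof

end
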